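import Literature.Geometry.Lorentzian.DataFamilyTangentKernel
import HarnessLib

/-!
# Tangents of smooth families of data with stationary constraints lie in `ker DΦ` — chart domains

Topic `Literature/Geometry/Lorentzian`. Everything here is PROVED; no definition, no statement of
`Prop` type is introduced.

`DataFamilyTangentKernel.lean` proves, for data on all of `E3 = ℝ³`, that the witnessed tangents of
the named fact `ChruscielDelay_localConstraintDeformation` (`LocalConstraintDeformation.lean`) —
fibrewise `s`-derivatives of a jointly smooth one-parameter family of data along which the
constraint functions are stationary — lie in the kernel of the coordinate linearised constraint
map `DΦ = (DH, DM)` (`MetricCoord.linHamFn`, `MetricCoord.linMomFn`; Chruściel–Delay 2003, §2;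
Bartnik–Isenberg 2004, (2.1)–(2.2)). This file proves the same for data on a CHART DOMAIN
`U : Opens E3`, the setting produced by reading data on a `3`-manifold through a chart
(`InitialDataSet.comap` along the inverse chart, `DataFamilyComap.lean`), with the coordinate
readings `coordHOn`, `coordKOn` (junk value `0` off `U`):

* `InitialDataSet.contDiffAt_coordHOn_family`, `contDiffAt_coordKOn_family` — for a smooth family
  of data on `U` (`IsSmoothDataFamily`) the readings `(c, z) ↦ coordHOn (F c) z`, `coordKOn`, are
  jointly `C^∞` at the points of `ℝᵐ × U` (the bundle of bilinear forms over `U` is trivialised by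
  the identity; compose with the smooth local inverse `(c, z) ↦ (c, chart⁻¹ z)` of the inclusion
  `ℝᵐ × U → ℝᵐ × E3`);
* `InitialDataSet.isMetricFamilyOn_coordHOn_line`, `contDiffOn_coordKOn_line` — along the axis
  `s ↦ s e₀` the readings form a smooth family of metric components on `U`
  (`MetricCoord.IsMetricFamilyOn`, time set `univ`);
* `InitialDataSet.linHamFn_lineTangent_eq_zero_chart`, `linMomFn_lineTangent_eq_zero_chart` —
  **stationary Hamiltonian / momentum constraint at `y ∈ U` ⇒ `DH(∂_s h, ∂_s k)(y) = 0`,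
  `DM(∂_s h, ∂_s k)(y) = 0`** (first-variation formulas
  `IsMetricFamilyOn.hasDerivWithinAt_hamAt_linHamFn` / `…momFn_linMomFn`, the bridge
  `OpensChart.hamiltonianConstraintFn_eq_hamAt` / `momentumConstraintFn_eq_momFn`, uniqueness of
  derivatives); `tDeriv_coordHOn_line_eq`, `tDeriv_coordKOn_line_eq` identify the variations
  with the fibrewise `deriv`-tangents on `U`.

## References

* P. T. Chruściel, E. Delay, Mém. Soc. Math. Fr. 94 (2003), §2. [ChruscielDelay2003]
* R. Bartnik, J. Isenberg, *The constraint equations* (2004), §2, (2.1)–(2.2). [BartnikIsenberg2004]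
-/

noncomputable section

set_option maxSynthPendingDepth 3

open Bundle Set Function Filter TopologicalSpace Manifold Module
open scoped Manifold ContDiff Topology

namespace Literature.Geometry.Lorentzian

namespace InitialDataSet

variable {U : Opens E3}

/-! ### Joint smoothness of the coordinate readings of a smooth family of data on `U` -/

section Family

variable {m : ℕ} (F : EuclideanSpace ℝ (Fin m) → InitialDataSet 𝓘(ℝ, E3) U)

/-- A jointly smooth family of sections of the bilinear-form bundle over the chart domain `U`,
read through the identity trivialisation, composed with `(c, z) ↦ (c, chart⁻¹ z)` and extended
by `0` off `U`, is jointly `C^∞` at the points of `ℝᵐ × U`. [folklore] -/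
theorem contDiffAt_repr_family
    {s : EuclideanSpace ℝ (Fin m) → Π y : U,
      TangentSpace 𝓘(ℝ, E3) y →L[ℝ] TangentSpace 𝓘(ℝ, E3) y →L[ℝ] ℝ}
    (hs : ContMDiff (𝓘(ℝ, EuclideanSpace ℝ (Fin m)).prod 𝓘(ℝ, E3))
      (𝓘(ℝ, E3).prod 𝓘(ℝ, E3 →L[ℝ] E3 →L[ℝ] ℝ)) ∞
      (fun q : EuclideanSpace ℝ (Fin m) × U ↦ TotalSpace.mk' (E3 →L[ℝ] E3 →L[ℝ] ℝ)
        (E := fun y : U ↦ TangentSpace 𝓘(ℝ, E3) y →L[ℝ] TangentSpace 𝓘(ℝ, E3) y →L[ℝ] ℝ) q.2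
        (s q.1 q.2)))
    (S : EuclideanSpace ℝ (Fin m) → E3 → E3 →L[ℝ] E3 →L[ℝ] ℝ)
    (hS : ∀ (c : EuclideanSpace ℝ (Fin m)) (y : U), S c y = s c y)
    {c₀ : EuclideanSpace ℝ (Fin m)} {z₀ : E3} (hz₀ : z₀ ∈ U) :
    ContDiffAt ℝ ∞ (fun p : EuclideanSpace ℝ (Fin m) × E3 ↦ S p.1 p.2) (c₀, z₀) := by
  set y₀ : U := ⟨z₀, hz₀⟩ with hy₀def
  -- Step 1: read through the identity trivialisation: `ContMDiffAt` on `ℝᵐ × U`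
  have h1 : ContMDiffAt (𝓘(ℝ, EuclideanSpace ℝ (Fin m)).prod 𝓘(ℝ, E3))
      𝓘(ℝ, E3 →L[ℝ] E3 →L[ℝ] ℝ) ∞
      (fun q : EuclideanSpace ℝ (Fin m) × U ↦ (show E3 →L[ℝ] E3 →L[ℝ] ℝ from s q.1 q.2))
      (c₀, y₀) := by
    have h := (contMDiffAt_bilin_iff (IX := (𝓘(ℝ, EuclideanSpace ℝ (Fin m))).prod 𝓘(ℝ, E3))
      (IB := 𝓘(ℝ, E3)) (V := (TangentSpace 𝓘(ℝ, E3) : U → Type _)) (b := Prod.snd)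
      (s := fun q : EuclideanSpace ℝ (Fin m) × U ↦ s q.1 q.2) (x₀ := (c₀, y₀))).1 (hs (c₀, y₀))
    have hsymm : ∀ (z : U) (v : E3),
        (trivializationAt E3 (TangentSpace 𝓘(ℝ, E3) : U → Type _) y₀).symmL ℝ z v = v := by
      intro z v
      rw [Trivialization.symmL_apply _ (by simp [OpensChart.chartAt_source])]
      exact OpensChart.trivializationAt_symm_apply y₀ z v
    have hfun : (fun x : EuclideanSpace ℝ (Fin m) × U ↦ (ContinuousLinearMap.precomp ℝ
        ((trivializationAt E3 (TangentSpace 𝓘(ℝ, E3) : U → Type _) y₀).symmL ℝ x.2)).comp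
          ((s x.1 x.2).comp
            ((trivializationAt E3 (TangentSpace 𝓘(ℝ, E3) : U → Type _) y₀).symmL ℝ x.2))) =
        fun q ↦ (show E3 →L[ℝ] E3 →L[ℝ] ℝ from s q.1 q.2) := by
      funext x
      ext v w
      simp only [ContinuousLinearMap.comp_apply, ContinuousLinearMap.precomp_apply, hsymm]
      rfl
    rw [hfun] at h
    exact h.2
  -- Step 2: compose with the smooth local inverse `(c, z) ↦ (c, chart⁻¹ z)` of the inclusion
  have hκ : ContMDiffAt (𝓘(ℝ, EuclideanSpace ℝ (Fin m)).prod 𝓘(ℝ, E3))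
      (𝓘(ℝ, EuclideanSpace ℝ (Fin m)).prod 𝓘(ℝ, E3)) ∞
      (fun p : EuclideanSpace ℝ (Fin m) × E3 ↦ (p.1, (chartAt E3 y₀).symm p.2)) (c₀, z₀) := by
    refine contMDiffAt_fst.prodMk ?_
    have hsm : ContMDiffAt 𝓘(ℝ, E3) 𝓘(ℝ, E3) ∞ (chartAt E3 y₀).symm z₀ :=
      (contMDiffOn_chart_symm (I := 𝓘(ℝ, E3)) (x := y₀)).contMDiffAt
        (by rw [OpensChart.chartAt_target]; exact U.2.mem_nhds hz₀)
    exact hsm.comp (c₀, z₀) contMDiffAt_snd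
  have hyz : (chartAt E3 y₀).symm z₀ = y₀ := Subtype.ext (OpensChart.chartAt_symm_val y₀ hz₀)
  have h2 : ContMDiffAt (𝓘(ℝ, EuclideanSpace ℝ (Fin m)).prod 𝓘(ℝ, E3))
      𝓘(ℝ, E3 →L[ℝ] E3 →L[ℝ] ℝ) ∞
      (fun p : EuclideanSpace ℝ (Fin m) × E3 ↦
        (show E3 →L[ℝ] E3 →L[ℝ] ℝ from s p.1 ((chartAt E3 y₀).symm p.2))) (c₀, z₀) := by
    have h1' : ContMDiffAt (𝓘(ℝ, EuclideanSpace ℝ (Fin m)).prod 𝓘(ℝ, E3))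
        𝓘(ℝ, E3 →L[ℝ] E3 →L[ℝ] ℝ) ∞
        (fun q : EuclideanSpace ℝ (Fin m) × U ↦ (show E3 →L[ℝ] E3 →L[ℝ] ℝ from s q.1 q.2))
        ((fun p : EuclideanSpace ℝ (Fin m) × E3 ↦ (p.1, (chartAt E3 y₀).symm p.2)) (c₀, z₀)) := by
      have hpt : (fun p : EuclideanSpace ℝ (Fin m) × E3 ↦ (p.1, (chartAt E3 y₀).symm p.2)) (c₀, z₀) =
          (c₀, y₀) := Prod.ext rfl hyz
      rw [hpt]
      exact h1
    exact h1'.comp (c₀, z₀) hκ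
  -- Step 3: near `(c₀, z₀)` this composite is the representative `S`
  have heq : (fun p : EuclideanSpace ℝ (Fin m) × E3 ↦ S p.1 p.2) =ᶠ[𝓝 (c₀, z₀)]
      fun p ↦ (show E3 →L[ℝ] E3 →L[ℝ] ℝ from s p.1 ((chartAt E3 y₀).symm p.2)) := by
    have hU : ∀ᶠ p : EuclideanSpace ℝ (Fin m) × E3 in 𝓝 (c₀, z₀), p.2 ∈ (U : Set E3) :=
      continuousAt_snd.preimage_mem_nhds (U.2.mem_nhds hz₀)
    filter_upwards [hU] with p hp
    have hp' : (chartAt E3 y₀).symm p.2 = ⟨p.2, hp⟩ :=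
      Subtype.ext (OpensChart.chartAt_symm_val y₀ hp)
    rw [hp', hS p.1 ⟨p.2, hp⟩]
  have h3 := h2.congr_of_eventuallyEq heq
  -- Step 4: on the product of model spaces `ContMDiffAt` is `ContDiffAt`
  rw [← modelWithCornersSelf_prod, chartedSpaceSelf_prod] at h3
  exact contMDiffAt_iff_contDiffAt.1 h3

/-- **The metric of a smooth family of data on a chart domain, read in coordinates, is jointly
smooth at the points of the domain**: `(c, z) ↦ coordHOn (F c) z` is `C^∞` at `(c₀, z₀)`,
`z₀ ∈ U`. [folklore] -/
theorem contDiffAt_coordHOn_family (hF : IsSmoothDataFamily m F) {c₀ : EuclideanSpace ℝ (Fin m)}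
    {z₀ : E3} (hz₀ : z₀ ∈ U) :
    ContDiffAt ℝ ∞ (fun p : EuclideanSpace ℝ (Fin m) × E3 ↦ (F p.1).coordHOn p.2) (c₀, z₀) :=
  contDiffAt_repr_family (s := fun c y ↦ (F c).h.inner y) hF.1 (fun c z ↦ (F c).coordHOn z)
    (fun c y ↦ by rw [coordHOn_of_mem _ y.2]) hz₀

/-- **The tensor `k` of a smooth family of data on a chart domain, read in coordinates, is
jointly smooth at the points of the domain.** [folklore] -/
theorem contDiffAt_coordKOn_family (hF : IsSmoothDataFamily m F) {c₀ : EuclideanSpace ℝ (Fin m)}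
    {z₀ : E3} (hz₀ : z₀ ∈ U) :
    ContDiffAt ℝ ∞ (fun p : EuclideanSpace ℝ (Fin m) × E3 ↦ (F p.1).coordKOn p.2) (c₀, z₀) :=
  contDiffAt_repr_family (s := fun c y ↦ (F c).k y) hF.2 (fun c z ↦ (F c).coordKOn z)
    (fun c y ↦ by rw [coordKOn_of_mem _ y.2]) hz₀

end Family

/-! ### The line family along the axis on a chart domain -/

section Line

variable (F : EuclideanSpace ℝ (Fin 1) → InitialDataSet 𝓘(ℝ, E3) U)

/-- `coordHOn` represents the metric on `U`. [folklore] -/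
theorem metric_val_eq_coordHOn (D : InitialDataSet 𝓘(ℝ, E3) U) (y : U) :
    D.metric.val y = D.coordHOn y := by
  rw [coordHOn_of_mem _ y.2]
  rfl

/-- `coordKOn` represents `k` on `U`. [folklore] -/
theorem k_eq_coordKOn (D : InitialDataSet 𝓘(ℝ, E3) U) (y : U) : D.k y = D.coordKOn y := by
  rw [coordKOn_of_mem _ y.2]

/-- **Along the axis, a smooth family of data on a chart domain is a smooth one-parameter family
of metric components on `U`** (`MetricCoord.IsMetricFamilyOn`, time set `univ`). [folklore] -/
theorem isMetricFamilyOn_coordHOn_line (hF : IsSmoothDataFamily 1 F) :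
    MetricCoord.IsMetricFamilyOn (fun s z ↦ (F (EuclideanSpace.single 0 s)).coordHOn z) univ
      (U : Set E3) where
  isMetricOn s _ := OpensChart.isMetricOn_repr (metric_val_eq_coordHOn (F (EuclideanSpace.single 0 s)))
  contDiffOn p hp := by
    have h := (contDiffAt_coordHOn_family F hF (c₀ := EuclideanSpace.single 0 p.2) hp.1).comp p
      ((contDiff_single_zero.comp contDiff_snd).prodMk contDiff_fst).contDiffAt
    exact h.contDiffWithinAt
  uniqueDiffOn := uniqueDiffOn_univ
  subset_closure_interior := by simp

/-- Along the axis, `(z, s) ↦ coordKOn (F (s e₀)) z` is `C^∞` on `U × ℝ`. [folklore] -/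
theorem contDiffOn_coordKOn_line (hF : IsSmoothDataFamily 1 F) :
    ContDiffOn ℝ ∞ (fun p : E3 × ℝ ↦ (F (EuclideanSpace.single 0 p.2)).coordKOn p.1)
      ((U : Set E3) ×ˢ univ) := by
  intro p hp
  have h := (contDiffAt_coordKOn_family F hF (c₀ := EuclideanSpace.single 0 p.2) hp.1).comp p
    ((contDiff_single_zero.comp contDiff_snd).prodMk contDiff_fst).contDiffAt
  exact h.contDiffWithinAt

/-- **The variation `∂_s h` at `s = 0` on `U` is the fibrewise tangent** `d/ds|₀ h_{s e₀}(y)`,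
`y ∈ U`. [folklore] -/
theorem tDeriv_coordHOn_line_eq (y : U) :
    MetricCoord.tDeriv (fun s z ↦ (F (EuclideanSpace.single 0 s)).coordHOn z) univ 0 y =
      deriv (fun s : ℝ ↦ (show E3 →L[ℝ] E3 →L[ℝ] ℝ from
        (F (EuclideanSpace.single 0 s)).h.inner y)) 0 := by
  rw [MetricCoord.tDeriv, derivWithin_univ]
  congr 1
  funext s
  rw [coordHOn_of_mem _ y.2]

/-- **The variation `∂_s k` at `s = 0` on `U` is the fibrewise tangent** `d/ds|₀ k_{s e₀}(y)`,
`y ∈ U`. [folklore] -/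
theorem tDeriv_coordKOn_line_eq (y : U) :
    MetricCoord.tDeriv (fun s z ↦ (F (EuclideanSpace.single 0 s)).coordKOn z) univ 0 y =
      deriv (fun s : ℝ ↦ (show E3 →L[ℝ] E3 →L[ℝ] ℝ from
        (F (EuclideanSpace.single 0 s)).k y)) 0 := by
  rw [MetricCoord.tDeriv, derivWithin_univ]
  congr 1
  funext s
  rw [coordKOn_of_mem _ y.2]

/-- The variation `∂_s h` at `s = 0` is `C^∞` on `U`. [folklore] -/
theorem contDiffOn_tDeriv_coordHOn_line (hF : IsSmoothDataFamily 1 F) :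
    ContDiffOn ℝ ∞ (MetricCoord.tDeriv (fun s z ↦ (F (EuclideanSpace.single 0 s)).coordHOn z)
      univ 0) (U : Set E3) :=
  (isMetricFamilyOn_coordHOn_line F hF).contDiffOn_tDeriv (mem_univ _)

/-- The variation `∂_s k` at `s = 0` is `C^∞` on `U`. [folklore] -/
theorem contDiffOn_tDeriv_coordKOn_line (hF : IsSmoothDataFamily 1 F) :
    ContDiffOn ℝ ∞ (MetricCoord.tDeriv (fun s z ↦ (F (EuclideanSpace.single 0 s)).coordKOn z)
      univ 0) (U : Set E3) :=
  MetricCoord.contDiffOn_derivWithin_tslice U.2 uniqueDiffOn_univ (contDiffOn_coordKOn_line F hF)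
    (mem_univ _)

/-! ### Stationary constraints ⇒ the variation is in the kernel of `DΦ` on `U` -/

/-- **Stationary Hamiltonian constraint at `y ∈ U` ⇒ `DH(∂_s h, ∂_s k)(y) = 0`** for a smooth
family of data on a chart domain (the constraint function on `U` is `hamAt` of the readings,
`OpensChart.hamiltonianConstraintFn_eq_hamAt`; its `s`-derivative is `DH` of the variations;
derivatives are unique). [cite: BartnikIsenberg2004, (2.1)] -/
theorem linHamFn_lineTangent_eq_zero_chart (hF : IsSmoothDataFamily 1 F) {ι : Type*} [Fintype ι]
    (b : Basis ι ℝ E3) (y : U)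
    (hH : HasDerivAt (fun s : ℝ ↦
      haveI := (F (EuclideanSpace.single 0 s)).metric.hasLeviCivita
      (F (EuclideanSpace.single 0 s)).hamiltonianConstraintFn y) 0 0) :
    MetricCoord.linHamFn b (F 0).coordHOn (F 0).coordKOn
      (MetricCoord.tDeriv (fun s z ↦ (F (EuclideanSpace.single 0 s)).coordHOn z) univ 0)
      (MetricCoord.tDeriv (fun s z ↦ (F (EuclideanSpace.single 0 s)).coordKOn z) univ 0) y = 0 := by
  have hfam := isMetricFamilyOn_coordHOn_line F hF
  have hK := contDiffOn_coordKOn_line F hF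
  have hKs : ∀ s ∈ (univ : Set ℝ), ∀ v w, (F (EuclideanSpace.single 0 s)).coordKOn y v w =
      (F (EuclideanSpace.single 0 s)).coordKOn y w v := by
    intro s _ v w
    rw [← k_eq_coordKOn]
    exact (F (EuclideanSpace.single 0 s)).k_symm y v w
  have hd := hfam.hasDerivWithinAt_hamAt_linHamFn b hK y.2 (mem_univ (0 : ℝ)) hKs
  have heq : (fun s : ℝ ↦ MetricCoord.hamAt (F (EuclideanSpace.single 0 s)).coordHOn
      (F (EuclideanSpace.single 0 s)).coordKOn y) =
      fun s : ℝ ↦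
        haveI := (F (EuclideanSpace.single 0 s)).metric.hasLeviCivita
        (F (EuclideanSpace.single 0 s)).hamiltonianConstraintFn y := by
    funext s
    haveI := (F (EuclideanSpace.single 0 s)).metric.hasLeviCivita
    exact (OpensChart.hamiltonianConstraintFn_eq_hamAt
      (metric_val_eq_coordHOn (F (EuclideanSpace.single 0 s)))
      (k_eq_coordKOn (F (EuclideanSpace.single 0 s))) y).symm
  have hd' := hasDerivWithinAt_univ.1 hd
  rw [heq] at hd'
  have hu := hd'.unique hH
  rw [show (F 0) = F (EuclideanSpace.single 0 (0 : ℝ)) by rw [single_zero_zero]]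
  exact hu

/-- **Stationary momentum constraint at `y ∈ U` ⇒ `DM(∂_s h, ∂_s k)(y)(Z) = 0`** for every
`Z`, for a smooth family of data on a chart domain. [cite: BartnikIsenberg2004, (2.2)] -/
theorem linMomFn_lineTangent_eq_zero_chart (hF : IsSmoothDataFamily 1 F) {ι : Type*} [Fintype ι]
    (b : Basis ι ℝ E3) (y : U)
    (hM : ∀ v : E3, HasDerivAt (fun s : ℝ ↦
      haveI := (F (EuclideanSpace.single 0 s)).metric.hasLeviCivita
      (F (EuclideanSpace.single 0 s)).momentumConstraintFn y v) 0 0) (Z : E3) :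
    MetricCoord.linMomFn b (F 0).coordHOn (F 0).coordKOn
      (MetricCoord.tDeriv (fun s z ↦ (F (EuclideanSpace.single 0 s)).coordHOn z) univ 0)
      (MetricCoord.tDeriv (fun s z ↦ (F (EuclideanSpace.single 0 s)).coordKOn z) univ 0) y Z = 0 := by
  have hfam := isMetricFamilyOn_coordHOn_line F hF
  have hK := contDiffOn_coordKOn_line F hF
  have hd := hfam.hasDerivWithinAt_momFn_linMomFn b
    (K := fun s z ↦ (F (EuclideanSpace.single 0 s)).coordKOn z) hK y.2 (mem_univ (0 : ℝ)) Z
  have heq : (fun s : ℝ ↦ MetricCoord.momFn b (F (EuclideanSpace.single 0 s)).coordHOn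
      (F (EuclideanSpace.single 0 s)).coordKOn y Z) =
      fun s : ℝ ↦
        haveI := (F (EuclideanSpace.single 0 s)).metric.hasLeviCivita
        (F (EuclideanSpace.single 0 s)).momentumConstraintFn y Z := by
    funext s
    haveI := (F (EuclideanSpace.single 0 s)).metric.hasLeviCivita
    exact (OpensChart.momentumConstraintFn_eq_momFn
      (metric_val_eq_coordHOn (F (EuclideanSpace.single 0 s)))
      (k_eq_coordKOn (F (EuclideanSpace.single 0 s))) b y Z).symm
  have hd' := hasDerivWithinAt_univ.1 hd
  rw [heq] at hd'
  have hu := hd'.unique (hM Z)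
  rw [show (F 0) = F (EuclideanSpace.single 0 (0 : ℝ)) by rw [single_zero_zero]]
  exact hu

end Line

end InitialDataSet

end Literature.Geometry.Lorentzian

end
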